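import Summits.QuantumFields.BalabanUV.Beta.GAN24.BornLambdaUndressedRow
import Summits.QuantumFields.BalabanUV.Beta.GAN24.RespStepEffectiveEL
import Summits.QuantumFields.BalabanUV.Beta.GAN24.TransverseDictionary
import Summits.QuantumFields.BalabanUV.Beta.GAN24.DecimatedKernelLegs
import Summits.QuantumFields.BalabanUV.Beta.GAN24.TaylorMassVHPush

/-!
# GAN24 ∕ BORNSEC, V half — `BornBorderTent`: THE TENT LEG (the multiplier slot of a multi-level Born lineage)

NOT IN PRINT; OUR BOOKKEEPING ([folklore] finite lattice algebra; no estimate of Bałaban's is formalised, cited or discharged here).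
HONEST: discharges NOTHING of `hB` ∕ `(hS, hSall)`; NEVER «G-an2-4 closed»; NOT (CONV-C), NOT D1, NOT `BetaPertH`, NOT continuum, NOT Clay.

WHAT.  In the undressed comparison of the comb family's V sector (`BornBorderLineage`, `BornBorderLift`) the step-`i` mixed pushes carry the
MULTIPLIER kernel legs `colM (dec (Lc^i) (KInv (N := Lc^(i+1)))) Lc` ∕ `rowMM …` of the decimated step resolvent; pushing further to level `Lc^k`
composes them (leaf-05's `Push3Nest.push₃_push₃`) with the response family `respStep (Lc^(i+1)) (Lc^k)`.  §1 computes that composite IN CLOSED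
FORM (`legComp_colM_dec_respStep`, `legComp_rowMM_dec_respStep`): it is the TENT LEG
`tentLeg Lc R N β z′ ν v = 𝟙[Lc ∣ v] · (𝒬_Rᵀ (q ↦ wΦ_N · β (q − z′))) ν (v ∕ Lc)` (`N = Lc^(i+1)·R`; an5's `wΦ_pair_respStep` — the E2-tent of
`RespStepEffectiveEL` — after the `mm` block of `KInv` is read at the `Lc^(i+1)`-coarse points, `KInv_inr_inr_coarse`, and vanishes off them).
§2 is the ADJOINT statement on road S3's side: reading a `pushSum Lc R`-ed multiplier index of a local family with the plain `mm` leg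
`colM (dec M (KInv (N := N))) L` (`N = M·L`, `L = Lc·R`) IS reading the un-pushed index with the same tent leg (`push₃_colM_pushSum`, and the row
version `push₃_rowMM_pushSum`) — the lattice adjointness `KKTFluctuationEnergy.lip1_contourSumAdj` of `𝒬_R` and `𝒬_Rᵀ` inside leaf-17's entry
formula `Push3.push₃_inl_inl`, with the sublattice bookkeeping of an5's `ResolventComposition.tsum_sublattice₀`.
Consumed by `BornBorderLiftChain` (the multi-level identification of the comb's undressed V lineage with road S3's rooted pushed border rows).

Unit `b2b-balaban-gan24-p1` (row owner G-an2-4, gen 21), 2026-08-21.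
-/

noncomputable section

open Finset
open scoped BigOperators
open Literature.MathematicalPhysics.QuantumFieldTheory
open Literature.MathematicalPhysics.QuantumFieldTheory.Balaban1983to89
open Literature.MathematicalPhysics.QuantumFieldTheory.Balaban1983to89.Beta
open Literature.Probability.LatticeModels (Torus.proj)
open LatticeForm (quo)
open B12Sec2to5 (l1 l1_nonneg)
open ExpKernelCalculus (MKer Decays BiLoc Zl Zl_nonneg summable_exp_shift' tsum_exp_shift')
open KernelSpecInstance (wH wΦ)
open AffineAveraging (Form1 contourSum box toSite unitVec)
open AffineReproduction (contourSumAdj)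
open OneStepResolventKernel (Fib LocStencil KInv decays_KInv KInv_inr_inr_coarse proj_zsmul quo_zsmul eq_zsmul_quo_of_proj)
open OneStepKernelFamily (dec legSet legPt legW LegIdx decays_dec)
open BalabanStepJets (locStencil_mono)
open BalabanCompositeJets (summable_slice_of_locStencil)
open AxialDressing (summable_col_of_biLoc)
open Summit.QuantumFields.BalabanUV.Beta.GAN24.Push4Bounds (LegDecay biLoc_vertexW_keep)
open Summit.QuantumFields.BalabanUV.Beta.GAN24.Push4NestAux (abs_le_of_decays)
open StepDriftWitness (sum_LegIdx_eq_contourSum)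
open KKTFluctuationEnergy (lip1 lip1_contourSumAdj summable_mul_of_bdd summable_mul_of_bdd')
open BalabanCompositeJets (respStep pushSum)
open Summit.QuantumFields.BalabanUV.Beta.GAN24.Push4 (legComp legComp_apply vertexW vertexW_apply)
open Summit.QuantumFields.BalabanUV.Beta.GAN24.Push3 (push₃ push₃_inl_inl push₃_inr_left push₃_inr_right)
open Summit.QuantumFields.BalabanUV.Beta.GAN24.SrecLinearPartEq (colM rowMM colM_apply rowMM_apply reslot reslot_inl_inl)
open Summit.QuantumFields.BalabanUV.Beta.GAN24.RespStepEffectiveEL (wΦ_pair_respStep)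
open Summit.QuantumFields.BalabanUV.Beta.GAN24.TransverseDictionary (wΦ_reciprocity)
open Summit.QuantumFields.BalabanUV.Beta.GAN24.DecimatedKernelLegs (KInv_inr_inr_of_proj_ne KInv_inr_inr_of_proj_ne_left proj_eq_zero_of_proj_zsmul)
open Summit.QuantumFields.BalabanUV.Beta.GAN24.TaylorMassVHPush (pushSum_inl_inr_coarse_sum pushSum_inr_inl_coarse_sum)
open Summit.QuantumFields.BalabanUV.Beta.GAN24.PushSumNest (pushSum_inr_of_proj_ne pushSum_inr_of_proj_ne')

namespace Summit.QuantumFields.BalabanUV.Beta.GAN24.BornBorderTent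

variable {d : ℕ}

/-! ## §0 The `mm` entries of a decimated kernel and of its multiplier legs -/

/-- [folklore] The (multiplier, multiplier) entry of a decimated kernel is the fine entry at the `M`-multiples (weight `1`, one leg point). -/
theorem dec_inr_inr (M : ℕ) (K : MKer (d + 1) (Fib d)) (μ ν : Fin (d + 1)) (x' y' : Fin (d + 1) → ℤ) :
    dec M K x' y' (Sum.inr μ) (Sum.inr ν) = K ((M : ℤ) • x') ((M : ℤ) • y') (Sum.inr μ) (Sum.inr ν) := by
  simp only [dec, legSet, legW, Finset.sum_singleton, one_mul]
  rfl

/-- [folklore] The `mm`-column leg of a decimated kernel: `colM (dec M K) L β z′ ν v = K (M•v) (M•L•z′) (inr ν) (inr β)`. -/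
theorem colM_dec_apply (M L : ℕ) (K : MKer (d + 1) (Fib d)) (β : Fin (d + 1)) (z' : Fin (d + 1) → ℤ) (ν : Fin (d + 1)) (v : Fin (d + 1) → ℤ) :
    colM (dec M K) L β z' ν v = K ((M : ℤ) • v) ((M : ℤ) • ((L : ℤ) • z')) (Sum.inr ν) (Sum.inr β) := by
  rw [colM_apply, dec_inr_inr]

/-- [folklore] The `mm`-row leg of a decimated kernel: `rowMM (dec M K) L α x′ μ x = K (M•L•x′) (M•x) (inr α) (inr μ)`. -/
theorem rowMM_dec_apply (M L : ℕ) (K : MKer (d + 1) (Fib d)) (α : Fin (d + 1)) (x' : Fin (d + 1) → ℤ) (μ : Fin (d + 1)) (x : Fin (d + 1) → ℤ) :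
    rowMM (dec M K) L α x' μ x = K ((M : ℤ) • ((L : ℤ) • x')) ((M : ℤ) • x) (Sum.inr α) (Sum.inr μ) := by
  rw [rowMM_apply, dec_inr_inr]

/-- [folklore] Nested blockings compose: `M•(L•w) = (M·L)•w`. -/
theorem zsmul_zsmul_cast (M L : ℕ) (w : Fin (d + 1) → ℤ) : (M : ℤ) • ((L : ℤ) • w) = ((M * L : ℕ) : ℤ) • w := by
  rw [smul_smul, Nat.cast_mul]

/-! ## §1 The tent leg and the composite multiplier legs -/

/-- [our object] **THE TENT LEG** at fine spacing `Lc`, block range `R`, coarse blocking `N`: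
`tentLeg Lc R N β z′ ν v := 𝟙[Lc ∣ v] · 𝒬_Rᵀ (fun κ q ↦ wΦ_N κ β (q − z′)) ν (v ∕ Lc)` — the response of the `mm` block of the level-`N` one-shot resolvent,
block-summed back over the `R` intermediate blocks (an5's E2-tent `RespStepEffectiveEL.wΦ_pair_respStep`), supported on the `Lc`-lattice. -/
def tentLeg (Lc R N : ℕ) [NeZero N] (β : Fin (d + 1)) (z' : Fin (d + 1) → ℤ) (ν : Fin (d + 1)) (v : Fin (d + 1) → ℤ) : ℝ :=
  if Torus.proj Lc v = 0 then contourSumAdj R (fun κ q => wΦ (N := N) (d := d) κ β (q - z')) ν (quo Lc v) else 0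

/-- [folklore] `tentLeg`, by `rfl`. -/
theorem tentLeg_apply (Lc R N : ℕ) [NeZero N] (β : Fin (d + 1)) (z' : Fin (d + 1) → ℤ) (ν : Fin (d + 1)) (v : Fin (d + 1) → ℤ) :
    tentLeg Lc R N β z' ν v
      = if Torus.proj Lc v = 0 then contourSumAdj R (fun κ q => wΦ (N := N) (d := d) κ β (q - z')) ν (quo Lc v) else 0 := rfl

/-- [folklore] The tent leg vanishes off the `Lc`-lattice. -/
theorem tentLeg_of_proj_ne (Lc R N : ℕ) [NeZero N] (β : Fin (d + 1)) (z' : Fin (d + 1) → ℤ) (ν : Fin (d + 1)) {v : Fin (d + 1) → ℤ}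
    (hv : Torus.proj Lc v ≠ 0) : tentLeg Lc R N β z' ν v = 0 := by
  rw [tentLeg_apply, if_neg hv]

/-- [folklore] The tent leg at the `Lc`-multiples. -/
theorem tentLeg_zsmul (Lc R N : ℕ) [NeZero Lc] [NeZero N] (β : Fin (d + 1)) (z' : Fin (d + 1) → ℤ) (ν : Fin (d + 1)) (w : Fin (d + 1) → ℤ) :
    tentLeg Lc R N β z' ν ((Lc : ℤ) • w) = contourSumAdj R (fun κ q => wΦ (N := N) (d := d) κ β (q - z')) ν w := by
  rw [tentLeg_apply, proj_zsmul, if_pos rfl, quo_zsmul]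

variable {M Lc R M' N : ℕ} [NeZero M] [NeZero Lc] [NeZero R] [NeZero M'] [NeZero N]

/-- NOT IN PRINT; OUR BOOKKEEPING ([folklore]).  **THE COMPOSITE `mm`-COLUMN LEG IS THE TENT LEG**: composing the `mm`-column leg of the decimated
step resolvent `dec M (KInv (N := M·Lc))` (relative blocking `Lc`) with the response family `respStep (M·Lc) N`, `N = M·Lc·R`, gives `tentLeg Lc R N`:
off the `Lc`-lattice the `mm` block of `KInv` vanishes (`KInv_inr_inr_of_proj_ne_left`); on it, `KInv_inr_inr_coarse` + reciprocity + an5's E2-tent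
`wΦ_pair_respStep`. -/
theorem legComp_colM_dec_respStep (hM' : M' = M * Lc) (hN : N = M' * R) (β : Fin (d + 1)) (z' : Fin (d + 1) → ℤ) (ν : Fin (d + 1))
    (v : Fin (d + 1) → ℤ) :
    legComp (colM (dec M (KInv (N := M') (d := d))) Lc) (respStep (d := d) M' N) β z' ν v = tentLeg Lc R N β z' ν v := by
  rw [legComp_apply, tentLeg_apply]
  simp only [colM_dec_apply, zsmul_zsmul_cast, ← hM']
  by_cases hv : Torus.proj Lc v = 0
  · rw [if_pos hv]
    obtain ⟨vb, hvb⟩ : ∃ vb, v = (Lc : ℤ) • vb := ⟨quo Lc v, eq_zsmul_quo_of_proj hv⟩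
    rw [hvb, quo_zsmul, zsmul_zsmul_cast, ← hM']
    simp only [KInv_inr_inr_coarse]
    rw [← wΦ_pair_respStep (d := d) hN β z' ν vb]
    refine tsum_congr fun w => Finset.sum_congr rfl fun lam _ => ?_
    rw [wΦ_reciprocity, mul_comm]
  · rw [if_neg hv]
    have hv' : Torus.proj M' ((M : ℤ) • v) ≠ 0 := fun h => hv (proj_eq_zero_of_proj_zsmul hM' h)
    simp only [KInv_inr_inr_of_proj_ne_left _ _ hv', mul_zero, Finset.sum_const_zero, tsum_zero]

/-- NOT IN PRINT; OUR BOOKKEEPING ([folklore]).  **THE COMPOSITE `mm`-ROW LEG IS THE SAME TENT LEG** (the left multiplier slot). -/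
theorem legComp_rowMM_dec_respStep (hM' : M' = M * Lc) (hN : N = M' * R) (α : Fin (d + 1)) (x' : Fin (d + 1) → ℤ) (μ : Fin (d + 1))
    (x : Fin (d + 1) → ℤ) :
    legComp (rowMM (dec M (KInv (N := M') (d := d))) Lc) (respStep (d := d) M' N) α x' μ x = tentLeg Lc R N α x' μ x := by
  rw [legComp_apply, tentLeg_apply]
  simp only [rowMM_dec_apply, zsmul_zsmul_cast, ← hM']
  by_cases hx : Torus.proj Lc x = 0
  · rw [if_pos hx]
    obtain ⟨xb, hxb⟩ : ∃ xb, x = (Lc : ℤ) • xb := ⟨quo Lc x, eq_zsmul_quo_of_proj hx⟩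
    rw [hxb, quo_zsmul, zsmul_zsmul_cast, ← hM']
    simp only [KInv_inr_inr_coarse]
    rw [← wΦ_pair_respStep (d := d) hN α x' μ xb]
    refine tsum_congr fun w => Finset.sum_congr rfl fun lam _ => ?_
    rw [mul_comm]
  · rw [if_neg hx]
    have hx' : Torus.proj M' ((M : ℤ) • x) ≠ 0 := fun h => hx (proj_eq_zero_of_proj_zsmul hM' h)
    simp only [KInv_inr_inr_of_proj_ne _ _ hx', mul_zero, Finset.sum_const_zero, tsum_zero]

/-! ## §2 The adjointness: a pushed multiplier index read by the plain `mm` leg = the un-pushed index read by the tent leg -/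

section Adjoint

variable (Lc R : ℕ) [NeZero Lc] [NeZero R]

/-- [folklore] **THE LATTICE ADJOINTNESS OF `𝒬_R` AND `𝒬_Rᵀ` IN PUSHED-INDEX FORM**: for a summable fine 1-form `F` and a leg `r` bounded at the
`(Lc·R)`-lattice points, `Σ'_z Σ_κ 𝟙[Lc·R ∣ z]·(Σ_{i ∈ LegIdx R} F κ (Lc•legPt R κ (z∕(Lc·R)) i))·r κ z = Σ'_v Σ_κ F κ v · 𝟙[Lc ∣ v]·𝒬_Rᵀ[q ↦ r · ((Lc·R)•q)] κ (v∕Lc)`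
(`KKTFluctuationEnergy.lip1_contourSumAdj` between two sublattice re-indexings `ResolventComposition.tsum_sublattice₀`). -/
theorem tsum_pushed_mul_eq (F r : Fin (d + 1) → (Fin (d + 1) → ℤ) → ℝ) {Cr : ℝ}
    (hF : ∀ κ, Summable (F κ)) (hr : ∀ κ q, |r κ (((Lc * R : ℕ) : ℤ) • q)| ≤ Cr) :
    ∑' z : Fin (d + 1) → ℤ, ∑ κ : Fin (d + 1),
        (if Torus.proj (Lc * R) z = 0 then ∑ i ∈ LegIdx d R, F κ ((Lc : ℤ) • legPt R (Sum.inl κ : Fib d) (quo (Lc * R) z) i) else 0) * r κ z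
      = ∑' v : Fin (d + 1) → ℤ, ∑ κ : Fin (d + 1),
        F κ v * (if Torus.proj Lc v = 0 then contourSumAdj R (fun κ' q => r κ' (((Lc * R : ℕ) : ℤ) • q)) κ (quo Lc v) else 0) := by
  haveI : NeZero (Lc * R) := ⟨mul_ne_zero (NeZero.ne Lc) (NeZero.ne R)⟩
  rw [ResolventComposition.tsum_sublattice₀ (Lc * R)
    (fun z => ∑ κ : Fin (d + 1),
        (if Torus.proj (Lc * R) z = 0 then ∑ i ∈ LegIdx d R, F κ ((Lc : ℤ) • legPt R (Sum.inl κ : Fib d) (quo (Lc * R) z) i) else 0) * r κ z)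
    (fun q => ∑ κ : Fin (d + 1), (∑ i ∈ LegIdx d R, F κ ((Lc : ℤ) • legPt R (Sum.inl κ : Fib d) q i)) * r κ (((Lc * R : ℕ) : ℤ) • q))
    (fun z hz => by simp only [if_neg hz, zero_mul, Finset.sum_const_zero])
    (fun q => by simp only [proj_zsmul, if_true, quo_zsmul])]
  rw [ResolventComposition.tsum_sublattice₀ Lc
    (fun v => ∑ κ : Fin (d + 1),
        F κ v * (if Torus.proj Lc v = 0 then contourSumAdj R (fun κ' q => r κ' (((Lc * R : ℕ) : ℤ) • q)) κ (quo Lc v) else 0))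
    (fun w => ∑ κ : Fin (d + 1), F κ ((Lc : ℤ) • w) * contourSumAdj R (fun κ' q => r κ' (((Lc * R : ℕ) : ℤ) • q)) κ w)
    (fun v hv => by simp only [if_neg hv, mul_zero, Finset.sum_const_zero])
    (fun w => by simp only [proj_zsmul, if_true, quo_zsmul])]
  have hA : ∀ κ, Summable (fun w : Fin (d + 1) → ℤ => F κ ((Lc : ℤ) • w)) := fun κ =>
    (hF κ).comp_injective (smul_right_injective (Fin (d + 1) → ℤ) (show (Lc : ℤ) ≠ 0 by exact_mod_cast NeZero.ne Lc))
  have h := lip1_contourSumAdj (N := R) (A := fun κ w => F κ ((Lc : ℤ) • w)) (φ := fun κ' q => r κ' (((Lc * R : ℕ) : ℤ) • q)) hA hr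
  simp only [lip1] at h
  rw [h]
  refine tsum_congr fun q => Finset.sum_congr rfl fun κ _ => ?_
  rw [← sum_LegIdx_eq_contourSum, mul_comm]

variable {Lc R}
variable {l w : Fin (d + 1) → (Fin (d + 1) → ℤ) → Fin (d + 1) → (Fin (d + 1) → ℤ) → ℝ} {Cl Cw m : ℝ} {Nw : ℕ}
variable {P : Fin (d + 1) → (Fin (d + 1) → ℤ) → MKer (d + 1) (Fib d)} {C δ : ℝ}

/-- [folklore] **`pushSum` ON THE MULTIPLIER COLUMN COMMUTES WITH THE VERTEX CONTRACTION**: the vertex of the pushed family, read in the channel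
(field, multiplier ↦ field), is the `(Lc·R)`-lattice indicator times the `R`-leg sum of the vertex of the un-pushed family at the pushed points. -/
theorem vertexW_reslot_pushSum_inl_inr (hw : ∀ μ y κ u, |w μ y κ u| ≤ Cw) (hP : LocStencil P C δ) (hδ : 0 < δ)
    (κ' : Fin (d + 1)) (u' x z : Fin (d + 1) → ℤ) (κ₁ κ₂ : Fin (d + 1)) :
    vertexW w (reslot Sum.inl Sum.inr fun κ u => pushSum Lc R (P κ u)) κ' u' x z (Sum.inl κ₁) (Sum.inl κ₂)
      = if Torus.proj (Lc * R) z = 0 then ∑ i ∈ LegIdx d R,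
          vertexW w (reslot Sum.inl Sum.inr P) κ' u' x ((Lc : ℤ) • legPt R (Sum.inl κ₂ : Fib d) (quo (Lc * R) z) i) (Sum.inl κ₁) (Sum.inl κ₂)
        else 0 := by
  haveI : NeZero (Lc * R) := ⟨mul_ne_zero (NeZero.ne Lc) (NeZero.ne R)⟩
  by_cases hz : Torus.proj (Lc * R) z = 0
  · rw [if_pos hz]
    obtain ⟨q, hq⟩ : ∃ q, z = ((Lc * R : ℕ) : ℤ) • q := ⟨quo (Lc * R) z, eq_zsmul_quo_of_proj hz⟩
    rw [hq, quo_zsmul]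
    simp only [vertexW_apply, reslot_inl_inl, pushSum_inl_inr_coarse_sum, Finset.mul_sum]
    rw [Finset.sum_comm]
    refine Finset.sum_congr rfl fun κ _ => ?_
    exact Summable.tsum_finsetSum fun i _ =>
      summable_mul_of_bdd (fun u => hw κ' u' κ u) (summable_slice_of_locStencil hP hδ κ x _ _ _)
  · rw [if_neg hz]
    simp only [vertexW_apply, reslot_inl_inl, pushSum_inr_of_proj_ne' Lc R hz, mul_zero, tsum_zero, Finset.sum_const_zero]

/-- [folklore] The same for the multiplier ROW (channel (multiplier ↦ field, field)): the indicator and leg sum sit on the first bond position. -/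
theorem vertexW_reslot_pushSum_inr_inl (hw : ∀ μ y κ u, |w μ y κ u| ≤ Cw) (hP : LocStencil P C δ) (hδ : 0 < δ)
    (κ' : Fin (d + 1)) (u' x z : Fin (d + 1) → ℤ) (κ₁ κ₂ : Fin (d + 1)) :
    vertexW w (reslot Sum.inr Sum.inl fun κ u => pushSum Lc R (P κ u)) κ' u' x z (Sum.inl κ₁) (Sum.inl κ₂)
      = if Torus.proj (Lc * R) x = 0 then ∑ i ∈ LegIdx d R,
          vertexW w (reslot Sum.inr Sum.inl P) κ' u' ((Lc : ℤ) • legPt R (Sum.inl κ₁ : Fib d) (quo (Lc * R) x) i) z (Sum.inl κ₁) (Sum.inl κ₂)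
        else 0 := by
  haveI : NeZero (Lc * R) := ⟨mul_ne_zero (NeZero.ne Lc) (NeZero.ne R)⟩
  by_cases hx : Torus.proj (Lc * R) x = 0
  · rw [if_pos hx]
    obtain ⟨q, hq⟩ : ∃ q, x = ((Lc * R : ℕ) : ℤ) • q := ⟨quo (Lc * R) x, eq_zsmul_quo_of_proj hx⟩
    rw [hq, quo_zsmul]
    simp only [vertexW_apply, reslot_inl_inl, pushSum_inr_inl_coarse_sum, Finset.mul_sum]
    rw [Finset.sum_comm]
    refine Finset.sum_congr rfl fun κ _ => ?_
    exact Summable.tsum_finsetSum fun i _ =>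
      summable_mul_of_bdd (fun u => hw κ' u' κ u) (summable_slice_of_locStencil hP hδ κ _ z _ _)
  · rw [if_neg hx]
    simp only [vertexW_apply, reslot_inl_inl, pushSum_inr_of_proj_ne Lc R hx, mul_zero, tsum_zero, Finset.sum_const_zero]

/-- [folklore] A LOCALISED table leg makes the vertex of a local family bi-localised; given that, a bounded left leg against it is summable in
the first bond position … -/
theorem summable_left_mul_vertexW (hl : ∀ α x' κ x, |l α x' κ x| ≤ Cl) (hw : LegDecay w Nw Cw m) (hm : 0 < m)
    {S : Fin (d + 1) → (Fin (d + 1) → ℤ) → MKer (d + 1) (Fib d)} {Cs : ℝ} (hS : LocStencil S Cs δ) (hδ : 0 < δ)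
    (κ' : Fin (d + 1)) (u' : Fin (d + 1) → ℤ) (α : Fin (d + 1)) (x' : Fin (d + 1) → ℤ) (κ₁ : Fin (d + 1)) (v : Fin (d + 1) → ℤ) (a b : Fib d) :
    Summable fun x => l α x' κ₁ x * vertexW w S κ' u' x v a b := by
  have hCs : 0 ≤ Cs := (hS 0 0).nonneg (Sum.inl 0)
  have hδ' : 0 < min δ (m / 4) := lt_min hδ (by linarith)
  have hB := biLoc_vertexW_keep hw (locStencil_mono hS hCs (min_le_left δ (m / 4))) hδ'.le
    (by linarith [min_le_right δ (m / 4)]) κ' u'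
  exact summable_mul_of_bdd (fun x => hl α x' κ₁ x) (summable_col_of_biLoc hB hδ' v a b)

/-- [folklore] … and the contracted left factor `v ↦ Σ'_x Σ_{κ₁} l α x′ κ₁ x · vertexW w S κ′ u′ x v a b` is summable in the second bond position. -/
theorem summable_leftContracted_vertexW (hl : ∀ α x' κ x, |l α x' κ x| ≤ Cl) (hw : LegDecay w Nw Cw m) (hm : 0 < m)
    {S : Fin (d + 1) → (Fin (d + 1) → ℤ) → MKer (d + 1) (Fib d)} {Cs : ℝ} (hS : LocStencil S Cs δ) (hδ : 0 < δ)
    (κ' : Fin (d + 1)) (u' : Fin (d + 1) → ℤ) (α : Fin (d + 1)) (x' : Fin (d + 1) → ℤ) (κ₂ : Fin (d + 1)) :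
    Summable fun v => ∑' x, ∑ κ₁ : Fin (d + 1), l α x' κ₁ x * vertexW w S κ' u' x v (Sum.inl κ₁) (Sum.inl κ₂) := by
  have hCs : 0 ≤ Cs := (hS 0 0).nonneg (Sum.inl 0)
  have hCl : 0 ≤ Cl := (abs_nonneg _).trans (hl 0 0 0 0)
  obtain ⟨δ', hδ', hδ'δ, h2⟩ : ∃ δ' : ℝ, 0 < δ' ∧ δ' ≤ δ ∧ 2 * δ' < m :=
    ⟨min δ (m / 4), lt_min hδ (by linarith), min_le_left _ _, by linarith [min_le_right δ (m / 4)]⟩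
  obtain ⟨CB, c, hCB, hB⟩ : ∃ (CB : ℝ) (c : Fin (d + 1) → ℤ), 0 ≤ CB ∧ BiLoc (vertexW w S κ' u') c c CB δ' :=
    ⟨_, _, (biLoc_vertexW_keep hw (locStencil_mono hS hCs hδ'δ) hδ'.le h2 κ' u').nonneg (Sum.inl 0),
      biLoc_vertexW_keep hw (locStencil_mono hS hCs hδ'δ) hδ'.le h2 κ' u'⟩
  refine Summable.of_norm_bounded ((summable_exp_shift' hδ' c).mul_left (((d + 1 : ℕ) : ℝ) * (Cl * CB) * Zl (d + 1) δ'))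
    (fun v => ?_)
  have hs := (summable_exp_shift' hδ' c).mul_left (((d + 1 : ℕ) : ℝ) * (Cl * CB) * Real.exp (-δ' * l1 (v - c)))
  have hb := tsum_of_norm_bounded hs.hasSum
    (f := fun x => ∑ κ₁ : Fin (d + 1), l α x' κ₁ x * vertexW w S κ' u' x v (Sum.inl κ₁) (Sum.inl κ₂))
    (fun x => by
      rw [Real.norm_eq_abs]
      calc |∑ κ₁ : Fin (d + 1), l α x' κ₁ x * vertexW w S κ' u' x v (Sum.inl κ₁) (Sum.inl κ₂)|
          ≤ ∑ κ₁ : Fin (d + 1), |l α x' κ₁ x * vertexW w S κ' u' x v (Sum.inl κ₁) (Sum.inl κ₂)| := Finset.abs_sum_le_sum_abs _ _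
        _ ≤ ∑ _κ₁ : Fin (d + 1), Cl * (CB * Real.exp (-δ' * (l1 (x - c) + l1 (v - c)))) :=
            Finset.sum_le_sum fun κ₁ _ => by
              rw [abs_mul]; exact mul_le_mul (hl α x' κ₁ x) (hB x v _ _) (abs_nonneg _) hCl
        _ = ((d + 1 : ℕ) : ℝ) * (Cl * CB) * Real.exp (-δ' * l1 (v - c)) * Real.exp (-δ' * l1 (x - c)) := by
            rw [Finset.sum_const, Finset.card_univ, Fintype.card_fin, nsmul_eq_mul, mul_add, Real.exp_add]; ring)
  rw [Real.norm_eq_abs] at hb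
  rw [Real.norm_eq_abs]
  refine hb.trans (le_of_eq ?_)
  rw [tsum_mul_left, tsum_exp_shift']
  ring

variable {M L N : ℕ} [NeZero N]

/-- NOT IN PRINT; OUR BOOKKEEPING ([folklore]).  **READING A PUSHED MULTIPLIER COLUMN WITH THE PLAIN `mm` LEG = READING THE UN-PUSHED COLUMN WITH THE
TENT LEG** (right kernel slot): for a bounded left leg, a localised table leg, a local family `P` and `N = M·L`, `L = Lc·R`,
`push₃ l (colM (dec M (KInv (N := N))) L) w (reslot inl inr (pushSum Lc R ∘ P)) = push₃ l (tentLeg Lc R N) w (reslot inl inr P)`. -/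
theorem push₃_colM_pushSum (hl : ∀ α x' κ x, |l α x' κ x| ≤ Cl) (hw : LegDecay w Nw Cw m) (hm : 0 < m) (hP : LocStencil P C δ)
    (hδ : 0 < δ) (hN : N = M * L) (hL : L = Lc * R) (κ' : Fin (d + 1)) (u' : Fin (d + 1) → ℤ) :
    push₃ l (colM (dec M (KInv (N := N) (d := d))) L) w (reslot Sum.inl Sum.inr fun κ u => pushSum Lc R (P κ u)) κ' u'
      = push₃ l (tentLeg Lc R N) w (reslot Sum.inl Sum.inr P) κ' u' := by
  haveI : NeZero (Lc * R) := ⟨mul_ne_zero (NeZero.ne Lc) (NeZero.ne R)⟩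
  obtain ⟨δK, CK, hδK, -, hK⟩ := decays_KInv (N := N) (d := d)
  have hwb : ∀ μ y κ u, |w μ y κ u| ≤ Cw := fun μ y κ u => hw.abs_le hm.le μ y κ u
  have hPr : LocStencil (reslot Sum.inl Sum.inr P) C δ := SrecLinearPartEq.locStencil_reslot hP _ _
  funext x' z' a b
  rcases a with α | μ
  · rcases b with β | ν
    · rw [push₃_inl_inl, push₃_inl_inl]
      -- the contracted left factor of the un-pushed family, read at the pushed points
      have key : ∀ z κ₂, (∑' x, ∑ κ₁ : Fin (d + 1), l α x' κ₁ x
            * vertexW w (reslot Sum.inl Sum.inr fun κ u => pushSum Lc R (P κ u)) κ' u' x z (Sum.inl κ₁) (Sum.inl κ₂))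
          = if Torus.proj (Lc * R) z = 0 then
              ∑ i ∈ LegIdx d R, (∑' x, ∑ κ₁ : Fin (d + 1), l α x' κ₁ x * vertexW w (reslot Sum.inl Sum.inr P) κ' u' x
                ((Lc : ℤ) • legPt R (Sum.inl κ₂ : Fib d) (quo (Lc * R) z) i) (Sum.inl κ₁) (Sum.inl κ₂)) else 0 := by
        intro z κ₂
        simp only [vertexW_reslot_pushSum_inl_inr hwb hP hδ]
        by_cases hz : Torus.proj (Lc * R) z = 0
        · simp only [if_pos hz, Finset.mul_sum]
          rw [← Summable.tsum_finsetSum (fun i _ => summable_sum fun κ₁ _ =>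
            summable_left_mul_vertexW hl hw hm hPr hδ κ' u' α x' κ₁ _ _ _)]
          exact tsum_congr fun x => Finset.sum_comm
        · simp only [if_neg hz, mul_zero, Finset.sum_const_zero, tsum_zero]
      have eL : (∑' z, ∑ κ₂ : Fin (d + 1), (∑' x, ∑ κ₁ : Fin (d + 1), l α x' κ₁ x
            * vertexW w (reslot Sum.inl Sum.inr fun κ u => pushSum Lc R (P κ u)) κ' u' x z (Sum.inl κ₁) (Sum.inl κ₂))
            * colM (dec M (KInv (N := N) (d := d))) L β z' κ₂ z)
          = ∑' z, ∑ κ₂ : Fin (d + 1), (if Torus.proj (Lc * R) z = 0 then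
              ∑ i ∈ LegIdx d R, (∑' x, ∑ κ₁ : Fin (d + 1), l α x' κ₁ x * vertexW w (reslot Sum.inl Sum.inr P) κ' u' x
                ((Lc : ℤ) • legPt R (Sum.inl κ₂ : Fib d) (quo (Lc * R) z) i) (Sum.inl κ₁) (Sum.inl κ₂)) else 0)
            * colM (dec M (KInv (N := N) (d := d))) L β z' κ₂ z :=
        tsum_congr fun z => Finset.sum_congr rfl fun κ₂ _ => by rw [key z κ₂]
      have hr : ∀ (κ₂ : Fin (d + 1)) (q : Fin (d + 1) → ℤ),
          |colM (dec M (KInv (N := N) (d := d))) L β z' κ₂ (((Lc * R : ℕ) : ℤ) • q)| ≤ CK := fun κ₂ q => by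
        rw [colM_dec_apply]; exact abs_le_of_decays hK hδK.le _ _ _ _
      have eA := tsum_pushed_mul_eq Lc R
        (fun κ₂ v => ∑' x, ∑ κ₁ : Fin (d + 1), l α x' κ₁ x * vertexW w (reslot Sum.inl Sum.inr P) κ' u' x v (Sum.inl κ₁) (Sum.inl κ₂))
        (fun κ₂ z => colM (dec M (KInv (N := N) (d := d))) L β z' κ₂ z)
        (fun κ₂ => summable_leftContracted_vertexW hl hw hm hPr hδ κ' u' α x' κ₂) hr
      beta_reduce at eA
      rw [eL, eA]
      refine tsum_congr fun v => Finset.sum_congr rfl fun κ₂ _ => ?_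
      rw [tentLeg_apply]
      simp only [colM_dec_apply, zsmul_zsmul_cast, ← hL, ← hN, KInv_inr_inr_coarse]
    · simp only [push₃_inr_right]
  · simp only [push₃_inr_left]

/-- [folklore] With a localised table leg, a column of the vertex of a local family is summable in the first bond position. -/
theorem summable_vertexW_col (hw : LegDecay w Nw Cw m) (hm : 0 < m)
    {S : Fin (d + 1) → (Fin (d + 1) → ℤ) → MKer (d + 1) (Fib d)} {Cs : ℝ} (hS : LocStencil S Cs δ) (hδ : 0 < δ)
    (κ' : Fin (d + 1)) (u' : Fin (d + 1) → ℤ) (z : Fin (d + 1) → ℤ) (a b : Fib d) :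
    Summable fun v => vertexW w S κ' u' v z a b := by
  have hCs : 0 ≤ Cs := (hS 0 0).nonneg (Sum.inl 0)
  have hδ' : 0 < min δ (m / 4) := lt_min hδ (by linarith)
  have hB := biLoc_vertexW_keep hw (locStencil_mono hS hCs (min_le_left δ (m / 4))) hδ'.le
    (by linarith [min_le_right δ (m / 4)]) κ' u'
  exact summable_col_of_biLoc hB hδ' z a b

/-- NOT IN PRINT; OUR BOOKKEEPING ([folklore]).  **THE ROW VERSION** (left kernel slot): for any right leg, a localised table leg, a local family `P`,
`push₃ (rowMM (dec M (KInv (N := N))) L) r w (reslot inr inl (pushSum Lc R ∘ P)) = push₃ (tentLeg Lc R N) r w (reslot inr inl P)` — the SAME tent leg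
(reciprocity `wΦ_N α κ (x′ − q) = wΦ_N κ α (q − x′)`).  Here the pushed index is the inner (first) bond position, so no exchange with the outer sum occurs. -/
theorem push₃_rowMM_pushSum {r : Fin (d + 1) → (Fin (d + 1) → ℤ) → Fin (d + 1) → (Fin (d + 1) → ℤ) → ℝ}
    (hw : LegDecay w Nw Cw m) (hm : 0 < m) (hP : LocStencil P C δ) (hδ : 0 < δ) (hN : N = M * L) (hL : L = Lc * R)
    (κ' : Fin (d + 1)) (u' : Fin (d + 1) → ℤ) :
    push₃ (rowMM (dec M (KInv (N := N) (d := d))) L) r w (reslot Sum.inr Sum.inl fun κ u => pushSum Lc R (P κ u)) κ' u'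
      = push₃ (tentLeg Lc R N) r w (reslot Sum.inr Sum.inl P) κ' u' := by
  haveI : NeZero (Lc * R) := ⟨mul_ne_zero (NeZero.ne Lc) (NeZero.ne R)⟩
  obtain ⟨δK, CK, hδK, -, hK⟩ := decays_KInv (N := N) (d := d)
  have hwb : ∀ μ y κ u, |w μ y κ u| ≤ Cw := fun μ y κ u => hw.abs_le hm.le μ y κ u
  have hPr : LocStencil (reslot Sum.inr Sum.inl P) C δ := SrecLinearPartEq.locStencil_reslot hP _ _
  funext x' z' a b
  rcases a with α | μ
  · rcases b with β | ν
    · rw [push₃_inl_inl, push₃_inl_inl]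
      refine tsum_congr fun z => Finset.sum_congr rfl fun κ₂ _ => ?_
      congr 1
      have hr : ∀ (κ₁ : Fin (d + 1)) (q : Fin (d + 1) → ℤ),
          |rowMM (dec M (KInv (N := N) (d := d))) L α x' κ₁ (((Lc * R : ℕ) : ℤ) • q)| ≤ CK := fun κ₁ q => by
        rw [rowMM_dec_apply]; exact abs_le_of_decays hK hδK.le _ _ _ _
      have eA := tsum_pushed_mul_eq Lc R
        (fun κ₁ v => vertexW w (reslot Sum.inr Sum.inl P) κ' u' v z (Sum.inl κ₁) (Sum.inl κ₂))
        (fun κ₁ x => rowMM (dec M (KInv (N := N) (d := d))) L α x' κ₁ x)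
        (fun κ₁ => summable_vertexW_col hw hm hPr hδ κ' u' z _ _) hr
      beta_reduce at eA
      calc (∑' x, ∑ κ₁ : Fin (d + 1), rowMM (dec M (KInv (N := N) (d := d))) L α x' κ₁ x
              * vertexW w (reslot Sum.inr Sum.inl fun κ u => pushSum Lc R (P κ u)) κ' u' x z (Sum.inl κ₁) (Sum.inl κ₂))
          = ∑' x, ∑ κ₁ : Fin (d + 1), (if Torus.proj (Lc * R) x = 0 then ∑ i ∈ LegIdx d R,
              vertexW w (reslot Sum.inr Sum.inl P) κ' u' ((Lc : ℤ) • legPt R (Sum.inl κ₁ : Fib d) (quo (Lc * R) x) i) z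
                (Sum.inl κ₁) (Sum.inl κ₂) else 0) * rowMM (dec M (KInv (N := N) (d := d))) L α x' κ₁ x :=
            tsum_congr fun x => Finset.sum_congr rfl fun κ₁ _ => by rw [vertexW_reslot_pushSum_inr_inl hwb hP hδ, mul_comm]
        _ = _ := eA
        _ = _ := tsum_congr fun v => Finset.sum_congr rfl fun κ₁ _ => by
            rw [mul_comm, tentLeg_apply]
            simp only [rowMM_dec_apply, zsmul_zsmul_cast, ← hL, ← hN, KInv_inr_inr_coarse, wΦ_reciprocity _ α]
    · simp only [push₃_inr_right]
  · simp only [push₃_inr_left]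

end Adjoint

end Summit.QuantumFields.BalabanUV.Beta.GAN24.BornBorderTent

end
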